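import Summits.HodgeConjecture.HodgeConjecture.Theses.EightfoldTwistedSheafSeeds
import Literature.AlgebraicGeometry.HodgeTheory.WeilClassesProductsOfFactorsFacts
import Literature.AlgebraicGeometry.Motives.HyperbolicWeilTypeProduct
import Literature.AlgebraicGeometry.HodgeTheory.WeilTypeProducts
import HarnessLib

/-!
# NODE (D-0171) — crux idea `weil-squared-anchor` for `SheafSeedGaussSq` (stmt-HodgeConjecture-30548)

Crux-ideate seat 1 (`cruxidea-stmt-HodgeConjecture-30548-1-g0`), round 1.  HONEST FRAMING: nothing here says 30548 / WeilSixfolds /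
18881 / H2 / HC_AV / HC_CM / HC holds; typed ≠ proved.  The crux is FIXED
(`Summit.HodgeConjecture.HodgeConjecture.Theses.EightfoldTwistedSheafSeeds.SheafSeedGaussSq`); this file only DECOMPOSES it.  0 sorries.

THE ANCHOR: the hyperbolic `ℚ(i)`-Weil eightfold `P = B × B^c`, `B` an abelian FOURFOLD with `ψ ≫ ψ = -𝟙` (Weil type `(2,2)`),
`B^c = (B, -ψ)`, `Ψ = ψ × (−ψ)`; in general `ψ ≫ ψ = -(m² • 𝟙)` (`ψ = m·η(i)` made integral, `K = ℚ(i)`, `Ψ ≫ Ψ = -(m² • 𝟙)`),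
product class `fst^* h + snd^* h` with `h = m²·h₀ + ψ^* h₀` (`ψ^* h = m²·h`, the crux's `h_K` shape).

NODE:  `SheafSeedGaussSq ⟸ AnchorHyperbolic ∧ SegreCompatible ∧ WeilSquaredSupply`  (`node_closes`, kernel-checked; the `m` of the
crux is the `m` of the supply).
* `AnchorHyperbolic`  — WEAKER (a true-on-paper lemma of linear algebra; does not mention sheaves): `(B × B^c, Ψ, h ⊞ h)` is of
  hyperbolic Weil type in half-dimension 4 for EVERY `ℚ(i)`-Weil fourfold.  Leaf `ConjugationAntiIsometry` (ATTACKABLE, matrix algebra)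
  + the tree's `Motives.isHyperbolicWeilType_prod_of_rationalModels` (graph Lagrangian).
* `SegreCompatible`   — WEAKER (infrastructure: Segre embedding of `B × B`, `(−ψ)^* = ψ^*` on `H²`); ATTACKABLE / INSTRUMENTABLE.
* `WeilSquaredSupply` — UNDECIDED (the heart; a SPECIALISATION of the crux's existential to the anchor with the hyperbolicity conjunct
  removed — it implies the crux only together with the two lemmas above, and is not implied by it): for every `C`, an
  `AdmTw'`-admissible `B₀`-twisted perfect object on `B × B^c` whose `κ₄` is `q·h_P⁴ + w`, `w ≠ 0` rational in the Weil line
  `E₊(B)⊠E₋(B) ⊕ E₋(B)⊠E₊(B)`, all other `κ_p ∈ ℚ h_P^p`.  Its own leaves (K1 fourfold Weil carrier — IDEA-NEEDED/ATTACKABLE at the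
  special point `B = X₂ × X̂₂`; K3 non-split Künneth gluing — IDEA-NEEDED; BARRIER leaf = the eightfold `e₂`-law / Euler squeeze) are on the card.
* `kunnethWeil_mem_weilClassesPlus` (PROVED from the tree): the anchor's Weil line is the exterior product of the factor Weil lines.
* `WeilPlusNeg` — leaf (ATTACKABLE): `E₊(B, −ψ) = E₋(B, ψ)`.
-/

noncomputable section

open CategoryTheory

namespace Summit.HodgeConjecture.HodgeConjecture.Cruxes.SheafSeedGaussSq.WeilSquaredAnchor

open Literature.AlgebraicTopology.SingularHomology
open Literature.AlgebraicGeometry Literature.AlgebraicGeometry.Motives Literature.AlgebraicGeometry.HodgeTheory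
open Summit.Ventures.HSemireg
open Summit.HodgeConjecture.HodgeConjecture.Theses.EightfoldTwistedSheafSeeds (SheafSeedGaussSq)

/-! ## The anchor's data -/

/-- `Ψ = ψ × (−ψ)` on `B × B` (the conjugate-twisted square). [cite: vanGeemen1994HodgeAV, 5.2] -/
abbrev Ψ (B : AbelianVariety ℂ) (ψ : B ⟶ B) : B.prod B ⟶ B.prod B :=
  AbelianVariety.prodLift (AbelianVariety.fst B B ≫ ψ) (AbelianVariety.snd B B ≫ (-ψ))

/-- `h ⊞ h := fst^* h + snd^* h` on `B × B`. [folklore] -/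
abbrev prodClass (B : AbelianVariety ℂ) (h : complexBetti B.X 2) : complexBetti (B.prod B).X 2 :=
  complexBetti.map (AbelianVariety.fst B B).hom.hom.hom 2 h + complexBetti.map (AbelianVariety.snd B B).hom.hom.hom 2 h

/-- `h := m²·h₀ + ψ^* h₀`, `h₀ = e₀^* a₀` (the `ψ`-symmetrised hyperplane class of `B`; `ψ^* h = m²·h` since `(ψ^*)² = m⁴` on `H²`).
[folklore] -/
abbrev anchorClass (m : ℕ) (B : AbelianVariety ℂ) (ψ : B ⟶ B) (e₀ : ProjectiveEmbedding B.X)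
    (a₀ : complexBetti (projectiveSpace e₀.n ℂ) 2) : complexBetti B.X 2 :=
  ((m ^ 2 : ℕ) : ℂ) • complexBetti.map e₀.ι 2 a₀ + complexBetti.map ψ.hom.hom.hom 2 (complexBetti.map e₀.ι 2 a₀)

/-- The crux's object class at the model `C`: `B₀`-twisted perfect objects, gluable-σ-semiregular ∨ BF′-single-sheaf admissible
(verbatim the crux's `𝒪`). [cite: BuchweitzFlenner2003, §4–5] -/
abbrev AdmTwClass (C : ChernCharacterBetti) : ObjClass :=
  twistedReflexiveClass C (fun n X₀ I E => gluableSigmaAdmissible n X₀ I E ∨ bfSingleAdmissible' n X₀ I E)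

/-! ## Leaves (ATTACKABLE) -/

/-- **Leaf (L0) conjugation anti-isometry** (pure matrix algebra over `ℚ`): for `M² = −m²` and an alternating `G` with `Mᵀ G M = m² G`
(the matrix of `ψ^*` on `H¹(B, ℚ)` and the Gram matrix of `q_h = ∫ · ∪ · ∪ h³`: `q_h(ψ^*x, ψ^*y) = m² q_h(x, y)` from `deg ψ = m⁸`,
`ψ^* h = m² h`) there is `F` with `F² = 1`, `FM = −MF`, `Fᵀ G F = −G`.  Pen proof: with `J = M/m`, `H(x,y) = G(x,Jy) + i·G(x,y)` is
`ℚ(i)`-hermitian; take an `H`-orthogonal `ℚ(i)`-basis and let `F` be coordinatewise conjugation. [cite: vanGeemen1994HodgeAV, Lemma 5.2] -/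
def ConjugationAntiIsometry : Prop :=
  ∀ (m k : ℕ) (M G : Matrix (Fin k) (Fin k) ℚ), 0 < m → M * M = -(((m ^ 2 : ℕ) : ℚ) • 1) → G.transpose = -G →
    M.transpose * G * M = ((m ^ 2 : ℕ) : ℚ) • G →
    ∃ F : Matrix (Fin k) (Fin k) ℚ, F * F = 1 ∧ F * M = -(M * F) ∧ F.transpose * G * F = -G

/-- **Leaf (L2b)**: the `+`-Weil line of `(B, −ψ)` is the `−`-Weil line of `(B, ψ)` (extension of the eigen-identity from `x y : ℕ`
to `ℤ` by polynomiality of `(x, y) ↦ (x𝟙 + yψ)^*`). [cite: vanGeemen1994HodgeAV, 4.8–4.9] -/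
def WeilPlusNeg : Prop :=
  ∀ (B : AbelianVariety ℂ) (ψ : B ⟶ B) (n d : ℕ), weilClassesPlus B (-ψ) n d = weilClassesMinus B ψ n d

/-! ## Pieces of the node -/

/-- **Piece A (WEAKER) — FIRST LEMMA of the card: the Weil-squared anchor is hyperbolic.**  For an abelian fourfold `B` with
`ψ ≫ ψ = −(m² • 𝟙 B)` and a rational `h ∈ H²(B)` with `ψ^* h = m² h`, `(B × B, ψ × (−ψ))` is of hyperbolic Weil type in half-dimension
`4` for `fst^* h + snd^* h`, WHATEVER the discriminant of `(B, ψ, h)` itself: `Q_{h ⊞ h}((x,y),(x',y')) = 35·deg(h⁴)·(q_h(x,x') + q_h(y,y'))`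
(no cross terms by parity), and the graph `{(x, F x)}` of (L0) (matrix of `ψ^*` on a rational basis of `H¹(B)`, Gram matrix of
`q_h = ∫ · ∪ · ∪ h³`) is a rational `Ψ`-stable Lagrangian — fed to `Motives.isHyperbolicWeilType_prod_of_rationalModels`.
[cite: vanGeemen1994HodgeAV, Lemma 5.2 (2)–(3), 5.4] [cite: Deligne1982HodgeCycles, §4, proof of Thm. 4.8] -/
def AnchorHyperbolic : Prop :=
  ∀ (m : ℕ) (B : AbelianVariety ℂ) (ψ : B ⟶ B) (h : complexBetti B.X 2), 0 < m → B.dim = 2 * 2 →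
    ψ ≫ ψ = -((m ^ 2 : ℕ) • 𝟙 B) → IsRationalClass h → complexBetti.map ψ.hom.hom.hom 2 h = ((m ^ 2 : ℕ) : ℂ) • h →
    IsHyperbolicWeilType (B.prod B) (Ψ B ψ) 4 (prodClass B h)

/-- **Piece E (WEAKER, infrastructure)**: the crux's polarisation binder is met on `B × B` — a projective embedding `e` (Segre of
`e₀ × e₀`, `e^* a = h₀ ⊞ h₀`) and a rational `a ≠ 0` with `m²·e^*a + Ψ^* e^*a = (m² h₀ + ψ^*h₀) ⊞ (m² h₀ + ψ^*h₀)` (uses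
`(−ψ)^* = ψ^*` on `H²`).
[cite: HartshorneAG, II Ex. 5.11 (Segre embedding)] [cite: FultonYoungTableaux1997, Appendix B §B.1] -/
def SegreCompatible : Prop :=
  ∀ (m : ℕ) (B : AbelianVariety ℂ) (ψ : B ⟶ B) (e₀ : ProjectiveEmbedding B.X) (a₀ : complexBetti (projectiveSpace e₀.n ℂ) 2),
    IsRationalClass a₀ → a₀ ≠ 0 →
    ∃ (e : ProjectiveEmbedding (B.prod B).X) (a : complexBetti (projectiveSpace e.n ℂ) 2),
      IsRationalClass a ∧ a ≠ 0 ∧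
      ((m ^ 2 : ℕ) : ℂ) • complexBetti.map e.ι 2 a + complexBetti.map (Ψ B ψ).hom.hom.hom 2 (complexBetti.map e.ι 2 a) =
        prodClass B (anchorClass m B ψ e₀ a₀)

/-- **Piece S (UNDECIDED — the heart): the Weil-squared SUPPLY.**  Some `m ≥ 1` and a `ℚ(i)`-Weil abelian fourfold `(B, ψ)`,
`ψ ≫ ψ = -(m² • 𝟙)`, with a hyperplane datum `(e₀, a₀)` such that for every model `C` of the Chern character some `AdmTw'`-admissible
`B₀`-twisted perfect object on `B × B^c` has `κ₄ = q·h⁴ + w` with `w ≠ 0` rational in the Weil line `weilClassesOf (B × B) Ψ 4 (m²)`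
(`= E₊(B)⊠E₋(B) ⊕ E₋(B)⊠E₊(B)`) and every other
`κ_p ∈ ℚ h^p`.  Intended suppliers: NON-SPLIT glued Künneth pairs of fourfold Weil carriers (card K1/K3); NOT box products, NOT
isogeny images, NOT split sums (cell (C1)–(C3)).  Test = the card's cheapest falsifier (`f₂`-count of the letter at `B = X₂ × X̂₂`).
[cite: Markman2025SecantWeil, Cor. 1.3.2, Lemma 6.2.3] [cite: BuchweitzFlenner2003, §4–5] [cite: Schoen1998HodgeWeilAddendum, §10] -/
def WeilSquaredSupply : Prop :=
  ∃ (m : ℕ) (B : AbelianVariety ℂ) (ψ : B ⟶ B) (e₀ : ProjectiveEmbedding B.X) (a₀ : complexBetti (projectiveSpace e₀.n ℂ) 2),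
    0 < m ∧ B.dim = 2 * 2 ∧ ψ ≫ ψ = -((m ^ 2 : ℕ) • 𝟙 B) ∧ IsRationalClass a₀ ∧ a₀ ≠ 0 ∧
    IsRationalClass (anchorClass m B ψ e₀ a₀) ∧
    complexBetti.map ψ.hom.hom.hom 2 (anchorClass m B ψ e₀ a₀) = ((m ^ 2 : ℕ) : ℂ) • anchorClass m B ψ e₀ a₀ ∧
    ∀ C : ChernCharacterBetti, ∃ w : complexBetti (B.prod B).X (2 * 4),
      w ∈ weilClassesOf (B.prod B) (Ψ B ψ) 4 (m ^ 2) ∧ IsRationalClass w ∧ w ≠ 0 ∧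
      HasSeedOn (AdmTwClass C) 4 (B.prod B) (prodClass B (anchorClass m B ψ e₀ a₀)) w

/-! ## Proved glue -/

/-- **(L2) Künneth–Weil, PROVED from the tree**: `fst^* u ∪ snd^* v ∈ E₊(B × B^c, Ψ)` for `u ∈ E₊(B, ψ)`, `v ∈ E₊(B, −ψ)` — the
Weil line of the anchor is the exterior product of the factor lines. [cite: Schoen1998HodgeWeilAddendum, §10 (proof, p. 333)] -/
theorem kunnethWeil_mem_weilClassesPlus (B : AbelianVariety ℂ) (ψ : B ⟶ B) {d : ℕ}
    {u v : complexBetti B.X (2 * 2)} (hu : u ∈ weilClassesPlus B ψ 2 d) (hv : v ∈ weilClassesPlus B (-ψ) 2 d) :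
    cupProduct (show 2 * 2 + 2 * 2 = 2 * 4 by norm_num)
        (complexBetti.map (AbelianVariety.fst B B).hom.hom.hom (2 * 2) u)
        (complexBetti.map (AbelianVariety.snd B B).hom.hom.hom (2 * 2) v) ∈
      weilClassesPlus (B.prod B) (Ψ B ψ) 4 d :=
  cupProduct_map_map_mem_weilClassesPlus (by rw [AbelianVariety.prodLift_fst]) (by rw [AbelianVariety.prodLift_snd]) _ hu hv

/-- A hyperbolic seed of the crux's class at `(N, d) = (4, 1)` for every `C` IS the crux with `m = 1`. [folklore] -/
theorem seed_shape (hseed : ∀ C : ChernCharacterBetti, HasHyperbolicSeedOn (AdmTwClass C) 4 1) : SheafSeedGaussSq :=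
  ⟨1, one_pos, fun C => by simpa using hseed C⟩

/-- **THE NODE, kernel-checked: `AnchorHyperbolic → SegreCompatible → WeilSquaredSupply → SheafSeedGaussSq`**
(`P := B × B`, `ψ₀ := ψ × (−ψ)`, the crux's `m` := the supply's `m`). [folklore] -/
theorem node_closes (hA : AnchorHyperbolic) (hE : SegreCompatible) (hS : WeilSquaredSupply) : SheafSeedGaussSq := by
  obtain ⟨m, B, ψ, e₀, a₀, hm, hB, hψ, ha₀, ha₀0, hh, hψh, hsup⟩ := hS
  refine ⟨m, hm, fun C => ?_⟩
  obtain ⟨w, hwW, hwr, hw0, hseed⟩ := hsup C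
  obtain ⟨e, a, ha, ha0, heq⟩ := hE m B ψ e₀ a₀ ha₀ ha₀0
  have hnψ : (-ψ) ≫ (-ψ) = -((m ^ 2 : ℕ) • 𝟙 B) := by rw [Preadditive.neg_comp_neg]; exact hψ
  refine ⟨B.prod B, Ψ B ψ, e, a, w, ?_, prodLift_comp_self_eq_neg hψ hnψ, ha, ha0, ?_, hwW, hwr, hw0, ?_⟩
  · rw [Motives.AbelianVariety.dim_prod, hB]
  · rw [heq]; exact hA m B ψ _ hm hB hψ hh hψh
  · rw [heq]; exact hseed

end Summit.HodgeConjecture.HodgeConjecture.Cruxes.SheafSeedGaussSq.WeilSquaredAnchor
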